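import Summits.RiemannHypothesis.RiemannHypothesis.Theorems.AsymptoticCriticalLine.Negative.BandForms
import Summits.RiemannHypothesis.RiemannHypothesis.Theorems.AsymptoticCriticalLine.Negative.ShapeFails
import Summits.RiemannHypothesis.RiemannHypothesis.Theorems.AsymptoticCriticalLine.Negative.DavenportHeilbronnBand

/-!
# `AsymptoticCriticalLine` (crux `stmt-RiemannHypothesis-2063`, route `RuelleBand`):
# the band shape fails for the Hurwitz zeta function `ζ(s, 1/5)` (negative-side support, cycle 2)

Support file of the crux disprover (cdisprove seat refuter-cdisprove-stmt-RiemannHypothesis-2063-g2-0),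
companion of `BandForms.lean` (`bandSet`), `ShapeFails.lean` (`fact_prime_five`,
`support_delta_finite`) and `DavenportHeilbronnBand.lean` (Titchmarsh's character `chi1Char` mod 5).

REFUTED STRENGTHENING (unconditional): Mathlib's Hurwitz zeta function `ζ(s, 1/5)`
(`hurwitzFifth = HurwitzZeta.hurwitzZeta (ZMod.toAddCircle (1 : ZMod 5))`) — the member
`a = 1/5` of the family `ζ(s, a) = ∑ (n + a)^{−s}` whose member `a = 0` is `riemannZeta`, with
Hurwitz's functional equation and the same growth — has `≥ cT` zeros with `3/4 < Re s < 1`,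
`|Im s| ≤ T` (Voronin 1976 / Gonek 1979 for rational `a ∉ {1/2, 1}`; here from the tree's PROVED
Saias–Weingartner theorem `Literature.Barriers.RiemannHypothesis.SaiasWeingartner_holds`), so its
level-`1/4` band is infinite (`not_band_hurwitzFifth`). The reduction is the identity
`∑_{χ mod 5} L(s, χ) = 4 · 5^{−s} ζ(s, 1/5)` (`sum_LFunction_five`, from Mathlib's definition of
`ZMod.LFunction` through Hurwitz zeta values, checked character value by character value), written
as a Saias–Weingartner sum over the PRIMITIVE family `{(1 − 5^{−s})·𝟙₁, χ₁, χ₁², χ₁³}`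
(`hw_sum_eq`; the trivial character mod 5 enters as `(1 − 5^{−s})ζ(s)`, Mathlib
`LFunctionTrivChar_eq_mul_riemannZeta`). ADDITIVE shifts of the Dirichlet series of `ζ` destroy the
band (no Euler product survives); within `{ζ(s, a) : a ∈ ℚ/ℤ}` the band shape is possible at most
for `a ∈ {0, 1/2}`.
-/

noncomputable section

namespace Summit.RiemannHypothesis.RiemannHypothesis.Theorems.AsymptoticCriticalLine.Negative

open Complex Set
open Literature.Barriers.RiemannHypothesis (chi1Val)

/-! ## 1. `ζ(s, 1/5)` as a Saias–Weingartner sum, and its strip zeros -/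


/-- `ζ(s, 1/5)`: Mathlib's Hurwitz zeta function at the parameter `1/5 ∈ ℝ/ℤ`
(`ZMod.toAddCircle (1 : ZMod 5)`); `riemannZeta` is the member `a = 0` of the same family.
[folklore] -/
def hurwitzFifth (s : ℂ) : ℂ :=
  HurwitzZeta.hurwitzZeta (ZMod.toAddCircle (1 : ZMod 5)) s

/-- Sums over `ZMod 5`, written out. [folklore] -/
theorem sum_zmod_five (f : ZMod 5 → ℂ) : ∑ j, f j = f 0 + f 1 + f 2 + f 3 + f 4 :=
  Fin.sum_univ_five f

/-- `L(s, χ) = 5^{−s} ∑_{j mod 5} χ(j) ζ(s, j/5)` for a character mod `5` (Mathlib's definition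
of `ZMod.LFunction` through Hurwitz zeta functions). [folklore] -/
theorem LFunction_five_eq (χ : DirichletCharacter ℂ 5) (s : ℂ) :
    χ.LFunction s = (5 : ℂ) ^ (-s) *
      (χ 0 * HurwitzZeta.hurwitzZeta (ZMod.toAddCircle (0 : ZMod 5)) s + χ 1 * HurwitzZeta.hurwitzZeta (ZMod.toAddCircle (1 : ZMod 5)) s +
        χ 2 * HurwitzZeta.hurwitzZeta (ZMod.toAddCircle (2 : ZMod 5)) s + χ 3 * HurwitzZeta.hurwitzZeta (ZMod.toAddCircle (3 : ZMod 5)) s +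
        χ 4 * HurwitzZeta.hurwitzZeta (ZMod.toAddCircle (4 : ZMod 5)) s) := by
  rw [DirichletCharacter.LFunction, ZMod.LFunction, sum_zmod_five]
  push_cast
  ring

/-- Values of `χ₁`: `(0, 1, i, −i, −1)`. [folklore] -/
theorem chi1Char_values :
    chi1Char 0 = 0 ∧ chi1Char 1 = 1 ∧ chi1Char 2 = I ∧ chi1Char 3 = -I ∧ chi1Char 4 = -1 := by
  simp [chi1Char_apply, chi1Val]

/-- Values of the trivial character mod `5`: `(0, 1, 1, 1, 1)`. [folklore] -/
theorem one_five_values :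
    (1 : DirichletCharacter ℂ 5) 0 = 0 ∧ (1 : DirichletCharacter ℂ 5) 1 = 1 ∧
      (1 : DirichletCharacter ℂ 5) 2 = 1 ∧ (1 : DirichletCharacter ℂ 5) 3 = 1 ∧
      (1 : DirichletCharacter ℂ 5) 4 = 1 := by
  refine ⟨MulChar.map_nonunit _ not_isUnit_zero, MulChar.one_apply isUnit_one, ?_, ?_, ?_⟩ <;>
    exact MulChar.one_apply (isUnit_iff_ne_zero.2 (by decide))

/-- THE KEY IDENTITY `∑_{χ mod 5} L(s, χ) = 4 · 5^{−s} ζ(s, 1/5)` (character orthogonality,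
checked value by value): the trivial character contributes `L(s, 𝟙₅) = (1 − 5^{−s}) ζ(s)`.
[folklore] -/
theorem sum_LFunction_five (s : ℂ) :
    (1 : DirichletCharacter ℂ 5).LFunction s + chi1Char.LFunction s + (chi1Char ^ 2).LFunction s +
        (chi1Char ^ 3).LFunction s = 4 * (5 : ℂ) ^ (-s) * hurwitzFifth s := by
  obtain ⟨h0, h1, h2, h3, h4⟩ := chi1Char_values
  obtain ⟨e0, e1, e2, e3, e4⟩ := one_five_values
  rw [LFunction_five_eq, LFunction_five_eq, LFunction_five_eq, LFunction_five_eq, hurwitzFifth]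
  simp only [MulChar.pow_apply' _ two_ne_zero, MulChar.pow_apply' _ three_ne_zero,
    h0, h1, h2, h3, h4, e0, e1, e2, e3, e4]
  linear_combination ((5 : ℂ) ^ (-s) * ((1 + I) * HurwitzZeta.hurwitzZeta (ZMod.toAddCircle (2 : ZMod 5)) s +
    (1 - I) * HurwitzZeta.hurwitzZeta (ZMod.toAddCircle (3 : ZMod 5)) s)) * I_sq

/-! The Saias–Weingartner family `{(1 − 5^{−s}) · 𝟙₁, χ₁, χ₁², χ₁³}` (levels `1, 5, 5, 5`). -/

/-- Levels. [folklore] -/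
def hwLevel : Bool × Bool → ℕ
  | (false, false) => 1
  | _ => 5

/-- [folklore] -/
instance hwLevel_neZero : ∀ p : Bool × Bool, NeZero (hwLevel p)
  | (false, false) => ⟨one_ne_zero⟩
  | (false, true) => ⟨by decide⟩
  | (true, false) => ⟨by decide⟩
  | (true, true) => ⟨by decide⟩

/-- Characters: the trivial character mod `1` and `χ₁, χ₁², χ₁³` mod `5`. [folklore] -/
def hwChar : ∀ p : Bool × Bool, DirichletCharacter ℂ (hwLevel p)
  | (false, false) => (1 : DirichletCharacter ℂ 1)
  | (false, true) => (chi1Char : DirichletCharacter ℂ 5)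
  | (true, false) => (chi1Char ^ 2 : DirichletCharacter ℂ 5)
  | (true, true) => (chi1Char ^ 3 : DirichletCharacter ℂ 5)

/-- The Dirichlet polynomial `1 − 5^{−s}` as coefficients `δ₁ − δ₅`. [folklore] -/
def fiveTwist : ℕ → ℂ := fun n => if n = 1 then 1 else if n = 5 then -1 else 0

/-- Coefficient polynomials: `1 − 5^{−s}` for the level-`1` member, `1` for the others. [folklore] -/
def hwPoly : Bool × Bool → ℕ → ℂ
  | (false, false) => fiveTwist
  | _ => LSeries.delta

/-- `LSeries (δ₁ − δ₅) s = 1 − 5^{−s}`. [folklore] -/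
theorem LSeries_fiveTwist (s : ℂ) : LSeries fiveTwist s = 1 - (5 : ℂ) ^ (-s) := by
  rw [LSeries, tsum_eq_sum (s := ({1, 5} : Finset ℕ))]
  · rw [Finset.sum_pair (by norm_num)]
    simp only [LSeries.term, fiveTwist, one_ne_zero, ↓reduceIte, Nat.cast_one, one_cpow, div_one,
      show (5 : ℕ) ≠ 0 by norm_num, show (5 : ℕ) ≠ 1 by norm_num, Nat.cast_ofNat]
    rw [cpow_neg, div_eq_mul_inv, neg_one_mul, sub_eq_add_neg]
  · intro n hn
    simp only [Finset.mem_insert, Finset.mem_singleton, not_or] at hn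
    rcases eq_or_ne n 0 with rfl | h0
    · simp [LSeries.term]
    · simp [LSeries.term, fiveTwist, hn.1, hn.2, h0]

/-- `χ₁^k ≠ 1` for `k = 1, 2, 3` (value at `2`: `i, −1, −i`). [folklore] -/
theorem chi1Char_pow_ne_one : chi1Char ≠ 1 ∧ chi1Char ^ 2 ≠ 1 ∧ chi1Char ^ 3 ≠ 1 := by
  have h2 : chi1Char 2 = I := chi1Char_values.2.2.1
  have e2 : (1 : DirichletCharacter ℂ 5) 2 = 1 := one_five_values.2.2.1
  refine ⟨chi1Char_ne_one, fun h => ?_, fun h => ?_⟩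
  · have := congrArg (fun χ : DirichletCharacter ℂ 5 => χ 2) h
    simp only [MulChar.pow_apply' _ two_ne_zero, h2, e2, I_sq] at this
    norm_num at this
  · have := congrArg (fun χ : DirichletCharacter ℂ 5 => (χ 2).im) h
    simp only [MulChar.pow_apply' _ three_ne_zero, h2, e2, one_im] at this
    rw [pow_succ, I_sq] at this
    norm_num at this

/-- All four members are primitive. [folklore] -/
theorem hwChar_isPrimitive : ∀ p : Bool × Bool, (hwChar p).IsPrimitive
  | (false, false) => by
      show (1 : DirichletCharacter ℂ 1).IsPrimitive
      rw [DirichletCharacter.isPrimitive_def]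
      exact DirichletCharacter.conductor_one
  | (false, true) => by
      show DirichletCharacter.IsPrimitive (chi1Char : DirichletCharacter ℂ 5)
      exact isPrimitive_of_ne_one_five chi1Char_pow_ne_one.1
  | (true, false) => by
      show DirichletCharacter.IsPrimitive (chi1Char ^ 2 : DirichletCharacter ℂ 5)
      exact isPrimitive_of_ne_one_five chi1Char_pow_ne_one.2.1
  | (true, true) => by
      show DirichletCharacter.IsPrimitive (chi1Char ^ 3 : DirichletCharacter ℂ 5)
      exact isPrimitive_of_ne_one_five chi1Char_pow_ne_one.2.2

/-- The three characters mod `5` are pairwise distinct (values `i, −1, −i` at `2`). [folklore] -/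
theorem chi1Char_pow_injective :
    chi1Char ≠ chi1Char ^ 2 ∧ chi1Char ≠ chi1Char ^ 3 ∧ chi1Char ^ 2 ≠ chi1Char ^ 3 := by
  have h2 : chi1Char 2 = I := chi1Char_values.2.2.1
  refine ⟨fun h => ?_, fun h => ?_, fun h => ?_⟩
  · have := congrArg (fun χ : DirichletCharacter ℂ 5 => (χ 2).im) h
    simp only [MulChar.pow_apply' _ two_ne_zero, h2, I_sq, I_im, neg_im, one_im] at this
    norm_num at this
  · have := congrArg (fun χ : DirichletCharacter ℂ 5 => (χ 2).im) h
    simp only [MulChar.pow_apply' _ three_ne_zero, h2, I_im] at this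
    rw [pow_succ, I_sq] at this
    norm_num at this
  · have := congrArg (fun χ : DirichletCharacter ℂ 5 => (χ 2).re) h
    simp only [MulChar.pow_apply' _ two_ne_zero, MulChar.pow_apply' _ three_ne_zero, h2, I_sq,
      neg_re, one_re] at this
    rw [pow_succ, I_sq] at this
    norm_num at this

/-- The family is injective as a map to `Σ n, DirichletCharacter ℂ n`. [folklore] -/
theorem hwSigma_injective :
    Function.Injective (fun p ↦ (⟨hwLevel p, hwChar p⟩ : Σ n, DirichletCharacter ℂ n)) := by
  obtain ⟨h12, h13, h23⟩ := chi1Char_pow_injective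
  intro a b hab
  rw [Sigma.mk.inj_iff] at hab
  obtain ⟨hfst, hsnd⟩ := hab
  rcases a with ⟨_ | _, _ | _⟩ <;> rcases b with ⟨_ | _, _ | _⟩
  · rfl
  · exact absurd hfst (by decide)
  · exact absurd hfst (by decide)
  · exact absurd hfst (by decide)
  · exact absurd hfst (by decide)
  · rfl
  · have h : (chi1Char : DirichletCharacter ℂ 5) = chi1Char ^ 2 := eq_of_heq hsnd
    exact absurd h h12
  · have h : (chi1Char : DirichletCharacter ℂ 5) = chi1Char ^ 3 := eq_of_heq hsnd
    exact absurd h h13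
  · exact absurd hfst (by decide)
  · have h : (chi1Char ^ 2 : DirichletCharacter ℂ 5) = chi1Char := eq_of_heq hsnd
    exact absurd h.symm h12
  · rfl
  · have h : (chi1Char ^ 2 : DirichletCharacter ℂ 5) = chi1Char ^ 3 := eq_of_heq hsnd
    exact absurd h h23
  · exact absurd hfst (by decide)
  · have h : (chi1Char ^ 3 : DirichletCharacter ℂ 5) = chi1Char := eq_of_heq hsnd
    exact absurd h.symm h13
  · have h : (chi1Char ^ 3 : DirichletCharacter ℂ 5) = chi1Char ^ 2 := eq_of_heq hsnd
    exact absurd h.symm h23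
  · rfl

/-- The coefficient polynomials are finitely supported and non-zero. [folklore] -/
theorem hwPoly_ok (p : Bool × Bool) :
    (Function.support (hwPoly p)).Finite ∧ ∃ n, n ≠ 0 ∧ hwPoly p n ≠ 0 := by
  rcases p with ⟨_ | _, _ | _⟩
  · refine ⟨(Finset.finite_toSet ({1, 5} : Finset ℕ)).subset fun n hn => ?_, 1, one_ne_zero, ?_⟩
    · simp only [Finset.coe_insert, Finset.coe_singleton, Set.mem_insert_iff, Set.mem_singleton_iff]
      by_contra h
      push Not at h
      exact hn (by simp [hwPoly, fiveTwist, h.1, h.2])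
    · simp [hwPoly, fiveTwist]
  all_goals exact ⟨support_delta_finite, 1, one_ne_zero, by simp [hwPoly, LSeries.delta]⟩

/-- The Saias–Weingartner sum of the family IS `4 · 5^{−s} ζ(s, 1/5)` (for `s ≠ 1`, where
`L(s, 𝟙₅) = (1 − 5^{−s})ζ(s)` is Mathlib's `LFunctionTrivChar_eq_mul_riemannZeta`). [folklore] -/
theorem hw_sum_eq {s : ℂ} (hs : s ≠ 1) :
    ∑ p : Bool × Bool, LSeries (hwPoly p) s * (hwChar p).LFunction s =
      4 * (5 : ℂ) ^ (-s) * hurwitzFifth s := by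
  rw [Fintype.sum_prod_type, Fintype.sum_bool, Fintype.sum_bool, Fintype.sum_bool]
  show LSeries LSeries.delta s * DirichletCharacter.LFunction (chi1Char ^ 3 : DirichletCharacter ℂ 5) s +
      LSeries LSeries.delta s * DirichletCharacter.LFunction (chi1Char ^ 2 : DirichletCharacter ℂ 5) s +
      (LSeries LSeries.delta s * DirichletCharacter.LFunction (chi1Char : DirichletCharacter ℂ 5) s +
        LSeries fiveTwist s * DirichletCharacter.LFunction (1 : DirichletCharacter ℂ 1) s) =
      4 * (5 : ℂ) ^ (-s) * hurwitzFifth s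
  rw [LSeries_fiveTwist, DirichletCharacter.LFunction_modOne_eq]
  simp only [LSeries_delta, Pi.one_apply, one_mul]
  have htriv : (1 - (5 : ℂ) ^ (-s)) * riemannZeta s = (1 : DirichletCharacter ℂ 5).LFunction s := by
    have h := DirichletCharacter.LFunctionTrivChar_eq_mul_riemannZeta (N := 5) hs
    rw [Nat.Prime.primeFactors Nat.prime_five, Finset.prod_singleton] at h
    push_cast at h
    exact h.symm
  rw [htriv, ← sum_LFunction_five s]
  ring

/-- REFUTED STRENGTHENING (unconditional; Voronin 1976 / Gonek 1979 for `ζ(s, a)`, `a` rational,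
here from the tree's PROVED Saias–Weingartner theorem `SaiasWeingartner_holds`): the Hurwitz zeta
function `ζ(s, 1/5)` — same summands `(n + a)^{−s}`, Hurwitz's functional equation, the member
`a = 1/5` of the family whose member `a = 0` is `ζ` — has `≥ cT` zeros with `3/4 < Re s < 1`,
`|Im s| ≤ T`: its level-`1/4` band is infinite. ADDITIVE shifts of the Dirichlet series destroy
the band (no Euler product); within `{ζ(s, a) : a ∈ ℚ/ℤ}` the band shape is possible at most for
`a ∈ {0, 1/2}` (`ζ` and `(2^s − 1)ζ`). [folklore] -/
theorem not_band_hurwitzFifth : ¬ ∀ ε : ℝ, 0 < ε → (bandSet hurwitzFifth ε).Finite := by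
  intro hband
  obtain ⟨η, hη, hstrip⟩ :=
    Literature.Barriers.RiemannHypothesis.SaiasWeingartner_holds (Bool × Bool) hwLevel hwChar hwPoly
      (by simp [Fintype.card_prod, Fintype.card_bool]) hwChar_isPrimitive hwSigma_injective hwPoly_ok
  obtain ⟨c, hc, T₀, hT⟩ := hstrip (3 / 4) 1 (by norm_num) (by norm_num) (by linarith)
  have hfin := hband (1 / 4) (by norm_num)
  set N : ℕ := hfin.toFinset.card with hN
  obtain ⟨Z, hZcard, hZ⟩ := hT (max T₀ (((N : ℝ) + 1) / c)) (le_max_left _ _)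
  have hZsub : ∀ s ∈ Z, s ∈ bandSet hurwitzFifth (1 / 4) := by
    intro s hs
    obtain ⟨h1, h2, _, h4⟩ := hZ s hs
    have hs1 : s ≠ 1 := fun h => by rw [h, one_re] at h2; exact lt_irrefl _ h2
    rw [hw_sum_eq hs1] at h4
    have h5 : (5 : ℂ) ^ (-s) ≠ 0 := by
      rw [Ne, Complex.cpow_eq_zero_iff, not_and_or]
      exact Or.inl (by norm_num)
    have hz : hurwitzFifth s = 0 := by
      rcases mul_eq_zero.1 h4 with h | h
      · exact absurd h (mul_ne_zero (by norm_num) h5)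
      · exact h
    refine ⟨hz, by linarith, h2, ?_⟩
    rw [abs_of_pos (by linarith)]
    linarith
  have hcard : Z.card ≤ N :=
    Finset.card_le_card fun s hs => (Set.Finite.mem_toFinset hfin).2 (hZsub s hs)
  have hge : (N : ℝ) + 1 ≤ c * max T₀ (((N : ℝ) + 1) / c) :=
    calc (N : ℝ) + 1 = c * (((N : ℝ) + 1) / c) := by field_simp
      _ ≤ c * max T₀ (((N : ℝ) + 1) / c) := by gcongr; exact le_max_right _ _
  have h1 : (N : ℝ) + 1 ≤ Z.card := hge.trans hZcard
  have h2 : (Z.card : ℝ) ≤ N := by exact_mod_cast hcard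
  linarith


end Summit.RiemannHypothesis.RiemannHypothesis.Theorems.AsymptoticCriticalLine.Negative

end
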